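import Mathlib
import HarnessLib
import Summits.ValiantsHypothesis.ValiantsHypothesis.Theses.MonotoneRestoration
import Summits.ValiantsHypothesis.ValiantsHypothesis.Theorems.MonotoneRestorationOrbitRestorationQPValueOrbitDivision
import Literature.Computability.AlgebraicComplexity.VPClosedUnderSum

/-!
# Route MonotoneRestoration, crux `OrbitRestorationQP` (stmt-18293) — ABSORBABLE HYPOTHESES ARE IDLE
# (the abstract form of the collapse of the simple-graph cut; helper, def-free)

`…OrbitRestorationQPBooleanWidthCollapse.lean` (p827686) shows that the Boolean circuit half `W₁` of the simple-graph cut is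
the whole crux, by ABSORBING its hypothesis into a multiplier.  This file isolates the principle, for the steward's use when
grading future cuts of L1:

* `orbitRestorationQP_of_absorbable` — **ABSORBABLE HYPOTHESES ARE IDLE.**  Let `Hyp` be ANY property of families.  Suppose
  there is a matrix-symmetric `VP` family `E`, orbit-restorable with a uniform constant, non-vanishing at some `Sym_n`-fixed
  base point `a_n` at every level `n ≥ 1`, such that `Hyp (E · h)` holds for EVERY matrix-symmetric `VP` family `h`
  ("`E` absorbs `Hyp`").  Then the conditional restoration statement
  `∀ f, matrix-symmetric → VP → Hyp f → (qp-orbit square-symmetric circuits)` already implies `OrbitRestorationQP`.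
  (Restore `E·h`, divide by `E` at `a_n` in orbit currency — `ValueOrbitDivision.qpOrbitRestorable_of_mul_eq_of_eval_ne_zero`;
  level `0` is free.)
* `orbitRestorationQP_iff_of_absorbable` — so such a conditional statement is EQUIVALENT to the crux: it cuts nothing off.

Instances: `Hyp f` = "eventually `C^{polylog}`-determined at `0/1` adjacency matrices of simple graphs" is absorbed by
`E_n = Π_{j ≤ n²} (U_n − j)` (p827686); more generally any hypothesis that only reads the values of `f n` on a set `Z_n`
avoided by an invariant restorable `VP` multiplier — e.g. all points with entries in a FIXED FINITE ALPHABET `S ⊂ ℂ`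
(`E_n = Π_{v ∈ ΣS-values} (U_n − v)`) — is idle.  Not absorbable (by `…LinearWidthMultiplierNoGo.lean`, p827520, modulo glued
indistinguishable pencils): the weighted hypothesis `PolylogHomDetermined` of line `linear_width`.
Honest label: propositional/algebraic glue over landed theorems; no stub closed; VP ≠ VNP untouched. [folklore; cite: Strassen1973, Satz 1]
-/

-- `Summit.ValiantsHypothesis.ValiantsHypothesis.…` is the tree's mandated namespace (Sub = Summit).
set_option linter.dupNamespace false

noncomputable section

open scoped Classical

namespace Summit.ValiantsHypothesis.ValiantsHypothesis.Theorems

namespace BooleanWidthCollapse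

open MvPolynomial
open Summit.ValiantsHypothesis.ValiantsHypothesis.Theses.MonotoneRestoration
open Literature.Computability.AlgebraicComplexity
open OrbitRestorationQPDepthThreeRung

/-- **ABSORBABLE HYPOTHESES ARE IDLE.**  If a matrix-symmetric `VP` family `E`, orbit-restorable with a uniform constant and
non-vanishing at `Sym_n`-fixed base points (levels `n ≥ 1`), absorbs the hypothesis `Hyp` (`Hyp (E·h)` for every
matrix-symmetric `VP` family `h`), then restoration conditional on `Hyp` implies `OrbitRestorationQP`. [cite: Strassen1973, Satz 1] -/
theorem orbitRestorationQP_of_absorbable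
    (Hyp : ((n : ℕ) → MvPolynomial (Fin n × Fin n) ℂ) → Prop)
    (E : (n : ℕ) → MvPolynomial (Fin n × Fin n) ℂ)
    (hEsymm : ∀ (n : ℕ) (σ τ : Equiv.Perm (Fin n)),
      MvPolynomial.rename (fun p : Fin n × Fin n => (σ p.1, τ p.2)) (E n) = E n)
    (hEVP : IsVPFamily E)
    (hEres : ∃ c : ℕ, ∀ n : ℕ, QPOrbitRestorable c n (E n))
    (a : (n : ℕ) → Fin n × Fin n → ℂ)
    (ha : ∀ (n : ℕ) (σ : Equiv.Perm (Fin n)) (x : Fin n × Fin n), a n (σ • x) = a n x)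
    (hEa : ∀ n : ℕ, 1 ≤ n → eval (a n) (E n) ≠ 0)
    (habs : ∀ h : (n : ℕ) → MvPolynomial (Fin n × Fin n) ℂ,
      (∀ (n : ℕ) (σ τ : Equiv.Perm (Fin n)),
        MvPolynomial.rename (fun p : Fin n × Fin n => (σ p.1, τ p.2)) (h n) = h n) →
      IsVPFamily h → Hyp (fun n => E n * h n))
    (hW : ∀ f : (n : ℕ) → MvPolynomial (Fin n × Fin n) ℂ,
      (∀ (n : ℕ) (σ τ : Equiv.Perm (Fin n)),
        MvPolynomial.rename (fun p : Fin n × Fin n => (σ p.1, τ p.2)) (f n) = f n) →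
      IsVPFamily f → Hyp f →
      ∃ c : ℕ, ∀ n : ℕ, ∃ (G : Type) (_ : Fintype G)
        (C : LabelledArithCircuit ℂ (Fin n × Fin n) Unit G),
        C.IsSymmetric (Equiv.Perm (Fin n)) ∧ C.eval (C.output ()) = f n ∧
          C.orbitSize (Equiv.Perm (Fin n)) ≤ 2 ^ ((Nat.log 2 n + c) ^ c)) :
    OrbitRestorationQP := by
  intro f hsymm hVP
  -- the absorbed family `F = E · f`
  have hFsymm : ∀ (n : ℕ) (σ τ : Equiv.Perm (Fin n)),
      MvPolynomial.rename (fun p : Fin n × Fin n => (σ p.1, τ p.2)) (E n * f n) = E n * f n := by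
    intro n σ τ
    rw [map_mul, hEsymm n σ τ, hsymm n σ τ]
  obtain ⟨c, hc⟩ := hW (fun n => E n * f n) hFsymm (hEVP.mul hVP) (habs f hsymm hVP)
  have hc' : ∀ n, QPOrbitRestorable c n (E n * f n) := fun n => hc n
  obtain ⟨cE, hcE⟩ := hEres
  refine ⟨max c cE + 38, fun n => ?_⟩
  have key : QPOrbitRestorable (max c cE + 38) n (f n) := by
    rcases Nat.eq_zero_or_pos n with hn | hn
    · subst hn
      have hinv : ∀ σ : Equiv.Perm (Fin 0), ren σ (f 0) = f 0 := fun σ => by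
        rw [ValueOrbit.ren_eq_of_matrixSymmetric (hsymm 0)]
      exact Restorable.qpOrbitRestorable_mono (by simp) (Restorable.qpOrbitRestorable_of_invariant (f 0) hinv)
    · exact ValueOrbitDivision.qpOrbitRestorable_of_mul_eq_of_eval_ne_zero (F := E n * f n) (D := E n) (h := f n)
        rfl (a n) (ha n) (hEa n hn)
        (Restorable.qpOrbitRestorable_mono (le_max_left _ _) (hc' n))
        (Restorable.qpOrbitRestorable_mono (le_max_right _ _) (hcE n))
  exact key

/-- **Hence a restoration statement with an absorbable hypothesis is EQUIVALENT to the crux** — it cuts nothing off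
`OrbitRestorationQP`. [folklore] -/
theorem orbitRestorationQP_iff_of_absorbable
    (Hyp : ((n : ℕ) → MvPolynomial (Fin n × Fin n) ℂ) → Prop)
    (E : (n : ℕ) → MvPolynomial (Fin n × Fin n) ℂ)
    (hEsymm : ∀ (n : ℕ) (σ τ : Equiv.Perm (Fin n)),
      MvPolynomial.rename (fun p : Fin n × Fin n => (σ p.1, τ p.2)) (E n) = E n)
    (hEVP : IsVPFamily E)
    (hEres : ∃ c : ℕ, ∀ n : ℕ, QPOrbitRestorable c n (E n))
    (a : (n : ℕ) → Fin n × Fin n → ℂ)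
    (ha : ∀ (n : ℕ) (σ : Equiv.Perm (Fin n)) (x : Fin n × Fin n), a n (σ • x) = a n x)
    (hEa : ∀ n : ℕ, 1 ≤ n → eval (a n) (E n) ≠ 0)
    (habs : ∀ h : (n : ℕ) → MvPolynomial (Fin n × Fin n) ℂ,
      (∀ (n : ℕ) (σ τ : Equiv.Perm (Fin n)),
        MvPolynomial.rename (fun p : Fin n × Fin n => (σ p.1, τ p.2)) (h n) = h n) →
      IsVPFamily h → Hyp (fun n => E n * h n)) :
    OrbitRestorationQP ↔
      ∀ f : (n : ℕ) → MvPolynomial (Fin n × Fin n) ℂ,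
        (∀ (n : ℕ) (σ τ : Equiv.Perm (Fin n)),
          MvPolynomial.rename (fun p : Fin n × Fin n => (σ p.1, τ p.2)) (f n) = f n) →
        IsVPFamily f → Hyp f →
        ∃ c : ℕ, ∀ n : ℕ, ∃ (G : Type) (_ : Fintype G)
          (C : LabelledArithCircuit ℂ (Fin n × Fin n) Unit G),
          C.IsSymmetric (Equiv.Perm (Fin n)) ∧ C.eval (C.output ()) = f n ∧
            C.orbitSize (Equiv.Perm (Fin n)) ≤ 2 ^ ((Nat.log 2 n + c) ^ c) :=
  ⟨fun hL1 f hs hVP _ => hL1 f hs hVP,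
    orbitRestorationQP_of_absorbable Hyp E hEsymm hEVP hEres a ha hEa habs⟩

end BooleanWidthCollapse

end Summit.ValiantsHypothesis.ValiantsHypothesis.Theorems

end
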